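import Summits.Ventures.PercRepro.MSTightConjTCandidate

/-!
# The one-sided completions of a family at a tightening direction, and Conjecture (T)

Dossier proofs/MINE1-theoremS.md, Addendum 46. For a family `F` and an element `r` with trace
`P = proj r F`, the two **one-sided completions** are
* `completion0 r F = F₀ ∪ (P + r)`: every member of the trace gets its `r`-lift (the partnerless
  `r`-free members are completed), and
* `completion1 r F = P ∪ (F₁ + r)`: every member of the trace is present `r`-free (the partnerless
  `r`-members are completed).

Both contain `F`, and their union `P ⊕ {∅, {r}}` is tight whenever `P` is. The main theorems need
NO excess hypothesis: if the trace `P` is tight and `completion0 r F` is tight, then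
`|P \\ F₀| ≤ |F₀|`, so by Marica–Schönheim `F₀ \\ F₀ = P \\ F₀`, `F₀` is tight and every type-I
difference `t ∖ s` (`t ∈ F₁`, `s ∈ F₀`) is an `F₀`-difference: `Y ⊆ D(F₀) ⊆ X`
(`diffsY_subset_diffsX_of_tight_completion0`); mirror for `completion1` with `F₁`.

The census statement (H3) of Addendum 46 — «at every tightening direction of an excess-one family
with `∩F, ∪F ∉ F`, one of the two completions is tight» (0 violations on all excess-one families
on `[4]`, `[5]` and on `[6]` with `|F| ≤ 16`; the excess pair
`(exc completion0, exc completion1) ∈ {(0,0), (0,1), (1,0)}` throughout) — is recorded as the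
candidate Prop `CompletionDichotomy α` (never asserted); `conjT_of_completionDichotomy` derives
`ConjT α` from it. It is the excess-one analogue of the tight dichotomy (Theorem S, Lemma B: for a
tight family one completion EQUALS `F`).
-/

namespace PercRepro.MSTight

open Finset
open scoped FinsetFamily

variable {α : Type*} [DecidableEq α] [Fintype α] {r : α} {F : Finset (Finset α)}

section Completions

/-- The completion on the `r`-free side: `F₀ ∪ (P + r)`, every member of the trace with `r` added. -/
def completion0 (r : α) (F : Finset (Finset α)) : Finset (Finset α) :=
  part0 r F ∪ (proj r F).image (insert r)

/-- The completion on the `r`-side: `P ∪ (F₁ + r)`, every member of the trace without `r`. -/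
def completion1 (r : α) (F : Finset (Finset α)) : Finset (Finset α) :=
  proj r F ∪ (partr r F).image (insert r)

omit [Fintype α] in
/-- Members of the trace avoid `r`. -/
theorem notMem_of_mem_proj_completion {A : Finset α} (hA : A ∈ proj r F) : r ∉ A := by
  obtain ⟨B, -, rfl⟩ := mem_proj.1 hA
  exact Finset.notMem_erase r B

omit [Fintype α] in
/-- `F₀ ⊆ P`. -/
theorem part0_subset_proj_completion : part0 r F ⊆ proj r F := by
  rw [proj_eq_union]; exact subset_union_left

omit [Fintype α] in
/-- `F₁ ⊆ P`. -/
theorem partr_subset_proj_completion : partr r F ⊆ proj r F := by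
  rw [proj_eq_union]; exact subset_union_right

omit [Fintype α] in
/-- `|completion0 r F| ≤ |F₀| + |P|`. -/
theorem card_completion0_le : (completion0 r F).card ≤ (part0 r F).card + (proj r F).card :=
  (card_union_le _ _).trans (Nat.add_le_add_left card_image_le _)

omit [Fintype α] in
/-- `|completion1 r F| ≤ |P| + |F₁|`. -/
theorem card_completion1_le : (completion1 r F).card ≤ (proj r F).card + (partr r F).card :=
  (card_union_le _ _).trans (Nat.add_le_add_left card_image_le _)

omit [Fintype α] in
/-- The `r`-free part of `completion0 r F` contains `F₀`. -/
theorem part0_subset_part0_completion0 : part0 r F ⊆ part0 r (completion0 r F) := by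
  intro A hA
  exact mem_part0.2 ⟨mem_union_left _ hA, (mem_part0.1 hA).2⟩

omit [Fintype α] in
/-- The `r`-part of `completion0 r F` contains the whole trace. -/
theorem proj_subset_partr_completion0 : proj r F ⊆ partr r (completion0 r F) := by
  intro A hA
  exact mem_partr.2 ⟨notMem_of_mem_proj_completion hA, mem_union_right _ (mem_image_of_mem _ hA)⟩

omit [Fintype α] in
/-- The `r`-free part of `completion1 r F` contains the whole trace. -/
theorem proj_subset_part0_completion1 : proj r F ⊆ part0 r (completion1 r F) := by
  intro A hA
  exact mem_part0.2 ⟨mem_union_left _ hA, notMem_of_mem_proj_completion hA⟩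

omit [Fintype α] in
/-- The `r`-part of `completion1 r F` contains `F₁`. -/
theorem partr_subset_partr_completion1 : partr r F ⊆ partr r (completion1 r F) := by
  intro A hA
  exact mem_partr.2 ⟨(mem_partr.1 hA).1, mem_union_right _ (mem_image_of_mem _ hA)⟩

end Completions

section Completion0

variable (hP : Tight (proj r F)) (hC : Tight (completion0 r F))
include hP hC

omit [Fintype α] in
/-- **The counting lemma for `completion0`:** a tight trace and a tight completion force
`|P \\ F₀| ≤ |F₀|` (the differences of `G = completion0 r F` contain `P \\ P` among the `r`-free
ones and `P \\ F₀` among the `r`-ones, while `|G| ≤ |F₀| + |P|`). -/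
theorem card_diffs_proj_part0_le_of_tight_completion0 :
    (proj r F \\ part0 r F).card ≤ (part0 r F).card := by
  have hX : proj r F \\ proj r F ⊆ diffsX r (completion0 r F) := by
    intro E hE
    exact mem_union_left _ (mem_union_right _
      (diffs_subset proj_subset_partr_completion0 proj_subset_partr_completion0 hE))
  have hY : proj r F \\ part0 r F ⊆ diffsY r (completion0 r F) :=
    diffs_subset proj_subset_partr_completion0 part0_subset_part0_completion0
  have h1 := card_diffs_eq_card_X_add_card_Y r (completion0 r F)
  have h2 : (completion0 r F \\ completion0 r F).card = (completion0 r F).card := hC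
  have h3 : (proj r F \\ proj r F).card = (proj r F).card := hP
  have h4 := card_completion0_le (r := r) (F := F)
  have h5 := card_le_card hX
  have h6 := card_le_card hY
  omega

omit [Fintype α] in
/-- With a tight trace and a tight `completion0`, `F₀ \\ F₀ = P \\ F₀` (Marica–Schönheim on `F₀`). -/
theorem diffs_part0_eq_of_tight_completion0 :
    part0 r F \\ part0 r F = proj r F \\ part0 r F := by
  apply eq_of_subset_of_card_le (diffs_subset_right part0_subset_proj_completion)
  exact (card_diffs_proj_part0_le_of_tight_completion0 hP hC).trans (card_le_card_diffs _)

omit [Fintype α] in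
/-- With a tight trace and a tight `completion0`, `F₀` is tight. -/
theorem tight_part0_of_tight_completion0 : Tight (part0 r F) := by
  apply le_antisymm
  · rw [diffs_part0_eq_of_tight_completion0 hP hC]
    exact card_diffs_proj_part0_le_of_tight_completion0 hP hC
  · exact card_le_card_diffs _

omit [Fintype α] in
/-- With a tight trace and a tight `completion0`, every type-I difference is an `F₀`-difference. -/
theorem diffsY_subset_diffs_part0_of_tight_completion0 :
    diffsY r F ⊆ part0 r F \\ part0 r F := by
  rw [diffs_part0_eq_of_tight_completion0 hP hC]
  exact diffs_subset_right partr_subset_proj_completion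

omit [Fintype α] in
/-- **Conjecture (T) from a tight `completion0`:** `Y ⊆ D(F₀) ⊆ X`. -/
theorem diffsY_subset_diffsX_of_tight_completion0 : diffsY r F ⊆ diffsX r F :=
  (diffsY_subset_diffs_part0_of_tight_completion0 hP hC).trans
    (subset_union_left.trans subset_union_left)

end Completion0

section Completion1

variable (hP : Tight (proj r F)) (hC : Tight (completion1 r F))
include hP hC

omit [Fintype α] in
/-- **The counting lemma for `completion1`:** a tight trace and a tight completion force
`|F₁ \\ P| ≤ |F₁|`. -/
theorem card_diffs_partr_proj_le_of_tight_completion1 :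
    (partr r F \\ proj r F).card ≤ (partr r F).card := by
  have hX : proj r F \\ proj r F ⊆ diffsX r (completion1 r F) := by
    intro E hE
    exact mem_union_left _ (mem_union_left _
      (diffs_subset proj_subset_part0_completion1 proj_subset_part0_completion1 hE))
  have hY : partr r F \\ proj r F ⊆ diffsY r (completion1 r F) :=
    diffs_subset partr_subset_partr_completion1 proj_subset_part0_completion1
  have h1 := card_diffs_eq_card_X_add_card_Y r (completion1 r F)
  have h2 : (completion1 r F \\ completion1 r F).card = (completion1 r F).card := hC
  have h3 : (proj r F \\ proj r F).card = (proj r F).card := hP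
  have h4 := card_completion1_le (r := r) (F := F)
  have h5 := card_le_card hX
  have h6 := card_le_card hY
  omega

omit [Fintype α] in
/-- With a tight trace and a tight `completion1`, `F₁ \\ F₁ = F₁ \\ P`. -/
theorem diffs_partr_eq_of_tight_completion1 :
    partr r F \\ partr r F = partr r F \\ proj r F := by
  apply eq_of_subset_of_card_le (diffs_subset_left partr_subset_proj_completion)
  exact (card_diffs_partr_proj_le_of_tight_completion1 hP hC).trans (card_le_card_diffs _)

omit [Fintype α] in
/-- With a tight trace and a tight `completion1`, `F₁` is tight. -/
theorem tight_partr_of_tight_completion1 : Tight (partr r F) := by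
  apply le_antisymm
  · rw [diffs_partr_eq_of_tight_completion1 hP hC]
    exact card_diffs_partr_proj_le_of_tight_completion1 hP hC
  · exact card_le_card_diffs _

omit [Fintype α] in
/-- With a tight trace and a tight `completion1`, every type-I difference is an `F₁`-difference. -/
theorem diffsY_subset_diffs_partr_of_tight_completion1 :
    diffsY r F ⊆ partr r F \\ partr r F := by
  rw [diffs_partr_eq_of_tight_completion1 hP hC]
  exact diffs_subset_left part0_subset_proj_completion

omit [Fintype α] in
/-- **Conjecture (T) from a tight `completion1`:** `Y ⊆ D(F₁) ⊆ X`. -/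
theorem diffsY_subset_diffsX_of_tight_completion1 : diffsY r F ⊆ diffsX r F :=
  (diffsY_subset_diffs_partr_of_tight_completion1 hP hC).trans
    (subset_union_right.trans subset_union_left)

end Completion1

omit [Fintype α] in
/-- **Conjecture (T) from a tight one-sided completion** (no excess hypothesis). -/
theorem diffsY_subset_diffsX_of_tight_completion (hP : Tight (proj r F))
    (hC : Tight (completion0 r F) ∨ Tight (completion1 r F)) : diffsY r F ⊆ diffsX r F := by
  rcases hC with hC | hC
  · exact diffsY_subset_diffsX_of_tight_completion0 hP hC
  · exact diffsY_subset_diffsX_of_tight_completion1 hP hC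

section Candidate

variable (α)

/-- **The completion dichotomy (H3), as a candidate Prop** (never asserted): at every tightening
direction of a family of Marica–Schönheim excess one with `∅, univ ∉ F`, full support and empty
core, one of the two one-sided completions `F₀ ∪ (P + r)`, `P ∪ (F₁ + r)` is tight. Census
(Addendum 46, own enumerator): 0 violations on all excess-one families with `∩F, ∪F ∉ F` on `[4]`,
`[5]` and on `[6]` with `|F| ≤ 16` (twins allowed), with
`(exc completion0, exc completion1) ∈ {(0,0), (0,1), (1,0)}` throughout. It is the excess-one
analogue of the tight dichotomy (Theorem S, Lemma B) and implies `ConjT α`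
(`conjT_of_completionDichotomy`). -/
def CompletionDichotomy : Prop :=
  ∀ (F : Finset (Finset α)) (r : α), (F \\ F).card = F.card + 1 →
    (∅ : Finset α) ∉ F → (univ : Finset α) ∉ F → (∀ a, ∃ t ∈ F, a ∉ t) → (∀ a, ∃ t ∈ F, a ∈ t) →
    Tight (proj r F) → Tight (completion0 r F) ∨ Tight (completion1 r F)

variable {α}

/-- **`ConjT α` from the completion dichotomy.** -/
theorem conjT_of_completionDichotomy (hD : CompletionDichotomy α) : ConjT α := by
  intro F r hF hE hU hcore hsupp hP
  exact diffsY_subset_diffsX_of_tight_completion hP (hD F r hF hE hU hcore hsupp hP)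

end Candidate

end PercRepro.MSTight
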